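import Mathlib
import Summits.Ventures.HodgeRepro2.A2TripleSumAssoc

/-!
# A2 annex — the Pontryagin product is commutative on even classes (`z ⋆ θ⁴ = θ⁴ ⋆ z`)

The sum map `m : B × B → B` is symmetric, so `a ⋆ b = ± b ⋆ a` with the Koszul sign of the degrees;
for `a` of even degree, `a ⋆ b = b ⋆ a`.  In the twelve-plane model this is the cocommutativity of
p5's coproduct `Δ = cop` under the braiding `comm` of the graded tensor product, together with the
symmetry of `II = ∫_B ⊗ ∫_B` (`II ∘ comm = II`: the braiding sign `(−1)^{ij}` is `1` whenever both
integrals can be non-zero, because the top degree `2|ι|` is even).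

* `comm_cop`: `comm (Δ u) = Δ u` (cocommutativity; `ExteriorAlgebra.hom_ext` on generators);
* `integral_eq_zero_of_mem_of_ne`: `∫_B x = 0` for `x ∈ ⋀^i`, `i ≠ 2|ι|`;
* **`II_comm`**: `II (comm Z) = II Z`;
* **`pontryagin_comm`**: `a ∈ ⋀^{2k} ⇒ a ⋆ b = b ⋆ a`; in particular `z ⋆ θ⁴ = θ⁴ ⋆ z` for the class `y`
  of Theorem A (`pontryagin_theta_pow_comm`).

Seat p6 (A2 owner), gen 16.  §8 (d): uses an L-value-free non-vanishing device: NO.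
-/

namespace Summit.Ventures.HodgeRepro2.A2PontryaginComm

open WeilPlanes WeilIntegral WeilCoproduct WeilPairing A2TripleSumPairingDegree A2IntegralDegree
  A2ModelDuality A2PontryaginModel A2TripleSumAssoc
open scoped TensorProduct

variable {ι : Type*} [DecidableEq ι]

/-- The braiding of the model, `comm : AA ι ≃ₐ AA ι`. -/
noncomputable abbrev braid : AA ι ≃ₐ[ℂ] AA ι := GradedTensorProduct.comm (grading ι) (grading ι)

/-- `x ᵍ⊗ 0 = 0`. -/
theorem gtmul_zero (x : A ι) : (x ᵍ⊗ₜ[ℂ] (0 : A ι) : AA ι) = 0 := by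
  simp [GradedTensorProduct.tmul]

/-- `x ᵍ⊗ (y + y') = x ᵍ⊗ y + x ᵍ⊗ y'`. -/
theorem gtmul_add (x y y' : A ι) :
    (x ᵍ⊗ₜ[ℂ] (y + y') : AA ι) = x ᵍ⊗ₜ[ℂ] y + x ᵍ⊗ₜ[ℂ] y' := by
  simp [GradedTensorProduct.tmul, TensorProduct.tmul_add]

/-- `comm (x ⊗ 1) = 1 ⊗ x` (degree-`0` right factor: no sign). -/
theorem braid_tmul_one (x : A ι) : braid (x ᵍ⊗ₜ[ℂ] (1 : A ι)) = (1 : A ι) ᵍ⊗ₜ[ℂ] x := by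
  induction x using DirectSum.Decomposition.inductionOn (ℳ := grading ι) with
  | zero => rw [zero_gtmul, map_zero, gtmul_zero]
  | homogeneous x =>
    have h := GradedTensorProduct.comm_coe_tmul_coe (grading ι) (grading ι) x
      (⟨(1 : A ι), SetLike.one_mem_graded _⟩ : grading ι 0)
    simpa [zero_mul, uzpow_zero, one_smul] using h
  | add x x' hx hx' =>
    rw [add_gtmul, map_add, hx, hx', gtmul_add]

/-- `comm (1 ⊗ y) = y ⊗ 1`. -/
theorem braid_one_tmul (y : A ι) : braid ((1 : A ι) ᵍ⊗ₜ[ℂ] y) = y ᵍ⊗ₜ[ℂ] (1 : A ι) := by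
  induction y using DirectSum.Decomposition.inductionOn (ℳ := grading ι) with
  | zero => rw [gtmul_zero, map_zero, zero_gtmul]
  | homogeneous y =>
    have h := GradedTensorProduct.comm_coe_tmul_coe (grading ι) (grading ι)
      (⟨(1 : A ι), SetLike.one_mem_graded _⟩ : grading ι 0) y
    simpa [mul_zero, uzpow_zero, one_smul] using h
  | add y y' hy hy' =>
    rw [gtmul_add, map_add, hy, hy', add_gtmul]

/-- Cocommutativity of the coproduct: `comm ∘ Δ = Δ` (the sum map is symmetric). -/
theorem braid_cop (u : A ι) : braid (cop u) = cop u := by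
  have h : (braid (ι := ι)).toAlgHom.comp cop = cop := by
    apply ExteriorAlgebra.hom_ext
    refine LinearMap.ext fun v => ?_
    change braid (cop (ExteriorAlgebra.ι ℂ v)) = cop (ExteriorAlgebra.ι ℂ v)
    rw [cop_ι, map_add, show inl (ExteriorAlgebra.ι ℂ v) = (ExteriorAlgebra.ι ℂ v) ᵍ⊗ₜ[ℂ] (1 : A ι)
      from GradedTensorProduct.includeLeft_apply _ _ _,
      show inr (ExteriorAlgebra.ι ℂ v) = (1 : A ι) ᵍ⊗ₜ[ℂ] (ExteriorAlgebra.ι ℂ v)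
      from GradedTensorProduct.includeRight_apply _ _ _, braid_tmul_one, braid_one_tmul, add_comm]
  exact congrArg (fun f => f u) h

/-- `∫_B x = 0` for `x` homogeneous of degree `≠ 2|ι|`. -/
theorem integral_eq_zero_of_mem_of_ne [Fintype ι] {i : ℕ} {x : A ι} (hx : x ∈ grading ι i)
    (hi : i ≠ Fintype.card (Gen ι)) : integral x = 0 := by
  have h := integral_mul_eq_zero_of_mem_of_mem hx (SetLike.one_mem_graded (grading ι))
    (by rwa [add_zero])
  rwa [mul_one] at h

/-- The braiding sign is harmless under the double integral: for `x ∈ ⋀^i`, `y ∈ ⋀^j`,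
`(−1)^{ji} ∫y ∫x = ∫x ∫y` (if `ji` is odd, `i` is odd and `∫x = 0`). -/
theorem sign_integral_mul [Fintype ι] {i j : ℕ} (x : grading ι i) (y : grading ι j) :
    ((-1 : ℂ) ^ (j * i)) * (integral (y : A ι) * integral (x : A ι)) =
      integral (x : A ι) * integral (y : A ι) := by
  rcases Nat.even_or_odd (j * i) with h | h
  · rw [h.neg_one_pow, one_mul, mul_comm]
  · have hi : Odd i := (Nat.odd_mul.mp h).2
    have hx0 : integral (x : A ι) = 0 := by
      refine integral_eq_zero_of_mem_of_ne x.2 ?_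
      intro heq
      rw [heq, card_gen] at hi
      exact (Nat.not_even_iff_odd.mpr hi) (even_two_mul _)
    rw [hx0, mul_zero, mul_zero, zero_mul]

/-- The symmetry of the double integral under the braiding: `II (comm Z) = II Z`. -/
theorem II_braid [Fintype ι] (Z : AA ι) : II (braid Z) = II Z := by
  induction Z using AA_induction with
  | zero => simp
  | tmul x y =>
    induction x using DirectSum.Decomposition.inductionOn (ℳ := grading ι) with
    | zero => simp [zero_gtmul]
    | homogeneous x =>
      induction y using DirectSum.Decomposition.inductionOn (ℳ := grading ι) with
      | zero => simp [gtmul_zero]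
      | homogeneous y =>
        rw [GradedTensorProduct.comm_coe_tmul_coe, neg_one_uzpow_smul, map_smul, II_tmul, II_tmul,
          smul_eq_mul, sign_integral_mul]
      | add y y' hy hy' => rw [gtmul_add, map_add, map_add, map_add, hy, hy']
    | add x x' hx hx' => rw [add_gtmul, map_add, map_add, map_add, hx, hx']
  | add Z Z' hZ hZ' => rw [map_add, map_add, map_add, hZ, hZ']

/-- **Commutativity of the Pontryagin product on even classes**: `a ∈ ⋀^{2k} ⇒ a ⋆ b = b ⋆ a`. -/
theorem pontryagin_comm [Fintype ι] {k : ℕ} {a : A ι} (ha : a ∈ grading ι (2 * k)) (b : A ι) :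
    pontryagin a b = pontryagin b a := by
  have hab : inr a * inl b = inl b * inr a := by
    calc inr a * inl b = inr a * (b ᵍ⊗ₜ[ℂ] (1 : A ι)) := by
          rw [show inl b = b ᵍ⊗ₜ[ℂ] (1 : A ι) from GradedTensorProduct.includeLeft_apply _ _ _]
      _ = b ᵍ⊗ₜ[ℂ] (a * 1) := inr_mul_tmul_of_even ha b 1
      _ = inl b * inr a := by rw [mul_one, inl_mul_inr]
  symm
  apply pontryagin_unique
  intro u
  rw [integral_pontryagin_mul, ← II_braid (inl a * inr b * cop u),
    map_mul (braid (ι := ι)) (inl a * inr b) (cop u), map_mul (braid (ι := ι)) (inl a) (inr b),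
    braid_cop,
    show inl a = a ᵍ⊗ₜ[ℂ] (1 : A ι) from GradedTensorProduct.includeLeft_apply _ _ _,
    show inr b = (1 : A ι) ᵍ⊗ₜ[ℂ] b from GradedTensorProduct.includeRight_apply _ _ _,
    braid_tmul_one, braid_one_tmul,
    show (1 : A ι) ᵍ⊗ₜ[ℂ] a = inr a from (GradedTensorProduct.includeRight_apply _ _ _).symm,
    show b ᵍ⊗ₜ[ℂ] (1 : A ι) = inl b from (GradedTensorProduct.includeLeft_apply _ _ _).symm, hab]

/-- `z ⋆ θ^r = θ^r ⋆ z`: the class `y` of Theorem A is symmetric in its two factors. -/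
theorem pontryagin_theta_pow_comm [Fintype ι] (z : A ι) (c : ι → ℂ) (r : ℕ) :
    pontryagin z (theta c ^ r) = pontryagin (theta c ^ r) z :=
  (pontryagin_comm (theta_pow_mem_grading c r) z).symm

end Summit.Ventures.HodgeRepro2.A2PontryaginComm
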